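import Mathlib
import HarnessLib

/-!
# Stub `stub_dvrNormalization` for crux stmt-ResolutionOfSingularities-15917 (`RadicialJung.CleanModels`)

Calibration of the crux in dimension one. Let `O` be a discrete valuation ring with fraction
field `K` and `L ⊋ K` a field of characteristic `p` with `L^p ⊆ K` (a height-one purely
inseparable extension). If the integral closure `B` of `O` in `L` is finite over `O`, then
`B` is a discrete valuation ring, `B^p ⊆ O`, and `B ⊄ K`.

Proof.
* `B^p ⊆ O`: for `b ∈ B`, `b^p = x ∈ K` is integral over `O`, hence lies in `O` since a DVR is
  integrally closed.
* `B ⊄ K`: for `y₀ ∈ L ∖ K` some nonzero `d ∈ O` makes `d y₀` integral (`L` is algebraic over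
  `O`), and `d y₀ ∉ K`.
* `B` is a DVR: it is a Noetherian (finite over `O`) domain of dimension `≤ 1` (integral over
  `O`), integrally closed in its fraction field `L`, hence Dedekind; it is not a field since `O`
  is not; and it is local because the non-units are closed under addition: `b ∈ B` is a unit iff
  `b^p ∈ O` is a unit of `O` (integral extensions reflect units), and `(a + b)^p = a^p + b^p`.
  A local Dedekind domain which is not a field is a DVR (`IsDiscreteValuationRing.TFAE`).
-/

set_option linter.dupNamespace false

namespace Summit.ResolutionOfSingularities.ResolutionOfSingularities.Theorems.RadicialJung.CleanModels

/-- **Normalisation of a DVR in a height-one purely inseparable extension.** For a DVR `O` with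
fraction field `K`, a field `L` of characteristic `p` over `K` with `L^p ⊆ K` and `L ≠ K`, and
`B = integralClosure O L` finite over `O`: `B` is a DVR, `B^p ⊆ O`, and `B ⊄ K`. -/
theorem stub_dvrNormalization {O K L : Type*} [CommRing O] [IsDomain O]
    [IsDiscreteValuationRing O] [Field K] [Algebra O K] [IsFractionRing O K] [Field L]
    [Algebra K L] [Algebra O L] [IsScalarTower O K L] (p : ℕ) (hp : p.Prime) [CharP L p]
    (hLp : ∀ y : L, ∃ x : K, algebraMap K L x = y ^ p)
    (hKL : ∃ y₀ : L, y₀ ∉ Set.range (algebraMap K L))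
    (hfin : Module.Finite O (integralClosure O L)) :
    IsDiscreteValuationRing (integralClosure O L) ∧
      (∀ b : integralClosure O L, ∃ s : O, algebraMap O L s = (b : L) ^ p) ∧
      (∃ b : integralClosure O L, (b : L) ∉ Set.range (algebraMap K L)) := by
  haveI : Fact p.Prime := ⟨hp⟩
  set B := integralClosure O L
  -- injectivity of the structure maps
  have hinjOL : Function.Injective (algebraMap O L) := by
    rw [IsScalarTower.algebraMap_eq O K L, RingHom.coe_comp]
    exact (algebraMap K L).injective.comp (IsFractionRing.injective O K)
  have hinjOB : Function.Injective (algebraMap O B) := by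
    have h := hinjOL
    rw [IsScalarTower.algebraMap_eq O B L, RingHom.coe_comp] at h
    exact Function.Injective.of_comp h
  haveI : FaithfulSMul O B := (faithfulSMul_iff_algebraMap_injective O B).mpr hinjOB
  -- `L` is algebraic over `K`, hence over `O`
  have hintKL : Algebra.IsIntegral K L := ⟨fun y => by
    obtain ⟨x, hx⟩ := hLp y
    exact IsIntegral.of_pow hp.pos (hx ▸ isIntegral_algebraMap)⟩
  haveI : Algebra.IsAlgebraic O L :=
    (IsFractionRing.comap_isAlgebraic_iff (A := O) (K := K) (C := L)).mpr inferInstance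
  -- (a) `B^p ⊆ O`
  have hBp : ∀ b : B, ∃ s : O, algebraMap O L s = (b : L) ^ p := by
    intro b
    obtain ⟨x, hx⟩ := hLp b
    have hxint : IsIntegral O x := by
      rw [← isIntegral_algebraMap_iff (B := L) (algebraMap K L).injective, hx]
      exact b.2.pow p
    obtain ⟨s, hs⟩ := IsIntegrallyClosed.algebraMap_eq_of_integral hxint
    exact ⟨s, by rw [IsScalarTower.algebraMap_apply O K L, hs, hx]⟩
  -- units of `B` are detected by their `p`-th powers in `O`
  have hunit : ∀ (b : B) (s : O), algebraMap O L s = (b : L) ^ p → (IsUnit b ↔ IsUnit s) := by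
    intro b s hs
    have hbs : b ^ p = algebraMap O B s := by
      apply Subtype.val_injective
      simp only [SubmonoidClass.coe_pow]
      rw [← hs, Subalgebra.coe_algebraMap]
    rw [← isUnit_pow_iff hp.ne_zero, hbs]
    exact isUnit_map_iff (algebraMap O B) s
  refine ⟨?_, hBp, ?_⟩
  · -- (c) `B` is a DVR
    haveI : IsNoetherianRing B := IsNoetherianRing.of_finite O B
    haveI : IsLocalRing B := IsLocalRing.of_nonunits_add fun a b ha hb => by
      obtain ⟨s, hs⟩ := hBp a
      obtain ⟨t, ht⟩ := hBp b
      have hst : algebraMap O L (s + t) = ((a + b : B) : L) ^ p := by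
        rw [map_add, hs, ht, Subalgebra.coe_add, add_pow_char]
      rw [mem_nonunits_iff, hunit _ _ hst]
      rw [mem_nonunits_iff, hunit _ _ hs] at ha
      rw [mem_nonunits_iff, hunit _ _ ht] at hb
      exact IsLocalRing.nonunits_add ha hb
    have hnf : ¬IsField B := fun h => IsDiscreteValuationRing.not_isField O
      ((Algebra.IsIntegral.isField_iff_isField hinjOB).mpr h)
    haveI : IsFractionRing B L := integralClosure.isFractionRing_of_algebraic
      fun x hx => hinjOL (by rw [hx, map_zero])
    have hDed : IsDedekindDomain B :=
      (isDedekindDomain_iff B L).mpr ⟨inferInstance, inferInstance, inferInstance,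
        fun {x} hx => ⟨⟨x, isIntegral_trans x hx⟩, rfl⟩⟩
    exact ((IsDiscreteValuationRing.TFAE B hnf).out 0 2).mpr hDed
  · -- (b) `B ⊄ K`
    obtain ⟨y₀, hy₀⟩ := hKL
    obtain ⟨d, hd, hint⟩ :=
      (Algebra.IsAlgebraic.isAlgebraic (R := O) y₀).exists_integral_multiple
    refine ⟨⟨d • y₀, hint⟩, ?_⟩
    rintro ⟨z, hz⟩
    apply hy₀
    have hd' : algebraMap O L d ≠ 0 := (map_ne_zero_iff _ hinjOL).mpr hd
    refine ⟨(algebraMap O K d)⁻¹ * z, ?_⟩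
    change algebraMap K L _ = d • y₀ at hz
    rw [map_mul, hz, map_inv₀, ← IsScalarTower.algebraMap_apply, Algebra.smul_def, ← mul_assoc,
      inv_mul_cancel₀ hd', one_mul]

end Summit.ResolutionOfSingularities.ResolutionOfSingularities.Theorems.RadicialJung.CleanModels
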